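import Mathlib
import HarnessLib

/-!
# The Global Convergence Theorem for descent algorithms (Zangwill; Luenberger–Ye, §6.6)

[LY08] = D. G. Luenberger, Y. Ye, *Linear and Nonlinear Programming* [LuenbergerYe2008], chapter
"Basic Properties of Solutions and Algorithms", §6.6 "Global convergence of descent algorithms"
in the held copy `book:luenberger2008-linear-nonlinear-programming` (§7.7 of the Springer 2008
printing): an *algorithm* is a point-to-set mapping `A : X → Set X` generating `x_{k+1} ∈ A(x_k)`;
a *descent function* for a solution set `Γ` and `A` is a continuous `Z` with `Z(y) < Z(x)` for
`y ∈ A(x)`, `x ∉ Γ`, and `Z(y) ≤ Z(x)` for `y ∈ A(x)`, `x ∈ Γ`; `A` is *closed at `x`* if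
`x_k → x`, `y_k ∈ A(x_k)`, `y_k → y` imply `y ∈ A(x)`. **Global Convergence Theorem** (Zangwill
[Z2]): if (i) all `x_k` lie in a compact set `S`, (ii) `Z` is a continuous descent function,
(iii) `A` is closed at points outside `Γ`, then the limit of any convergent subsequence of `(x_k)`
is a solution; **Corollary**: if `Γ = {xbar}` then `x_k → xbar`.

Compactness enters the proof only through the extraction of convergent subsequences, so
hypothesis (i) is recorded as `IsSeqCompact S` (for metric / first-countable spaces
`IsCompact.isSeqCompact` supplies it; `tendsto_subseq_of_compact` below is that remark).

Results recorded:
* `SeqClosedAt`, `IsDescentFunction` — the two definitions;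
* `antitone_descent` — `Z(x_k)` is nonincreasing along the algorithm;
* `tendsto_descent_of_subseq` — the first half of the proof: if a subsequence converges to `x`,
  then `Z(x_k) → Z(x)` along the WHOLE sequence;
* `tendsto_value_of_subseq`, `mem_solutionSet_of_spacer` — the two halves of the proof in the
  generality shared with the Spacer Step Theorem;
* `globalConvergence` — the **Global Convergence Theorem**; `spacerStep` — the **Spacer Step
  Theorem** of §7.10;
* `tendsto_of_solutionSet_singleton` — the **Corollary** (`Γ = {xbar}` ⇒ `x_k → xbar`).
* `seqClosedAt_singleton_of_continuousAt` (Example 2), `SeqClosedAt.comp_continuousAt`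
  (Corollary 2 on composite mappings), and Example 4 (`example4Map`,
  `example4_isDescentFunction`, `example4_not_seqClosedAt_one`, `example4_iterate`,
  `example4_tendsto_one_notMem`): closedness outside `Γ` cannot be dropped;
* `tendsto_subseq_of_compact` — hypothesis (i) in metric spaces.

Published results only (Lean placement rule): every public declaration carries its
`[cite: LuenbergerYe2008, §6.6 …]` locator.
-/

namespace Literature.Analysis.Convex.ZangwillGlobalConvergence

open Filter Topology

variable {X Y W : Type*} [TopologicalSpace X] [TopologicalSpace Y] [TopologicalSpace W]

/-- The point-to-set mapping `A` from `X` to `Y` is *closed at `x`*: `x_k → x`, `y_k ∈ A(x_k)`,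
`y_k → y` imply `y ∈ A(x)`. [cite: LuenbergerYe2008, §6.6 Definition (closed mapping)] -/
def SeqClosedAt (A : X → Set Y) (x : X) : Prop :=
  ∀ (u : ℕ → X) (v : ℕ → Y) (y : Y), Tendsto u atTop (𝓝 x) → (∀ k, v k ∈ A (u k)) →
    Tendsto v atTop (𝓝 y) → y ∈ A x

/-- Example 2: a point-to-point mapping continuous at `x` is closed at `x` (limits being unique).
[cite: LuenbergerYe2008, §6.6 Example 2 ("for point-to-point mappings continuity implies
closedness")] -/
theorem seqClosedAt_singleton_of_continuousAt [T2Space Y] {f : X → Y} {x : X}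
    (hf : ContinuousAt f x) : SeqClosedAt (fun x' => ({f x'} : Set Y)) x := by
  intro u v y hu hv hy
  have hv' : v = f ∘ u := funext fun k => hv k
  subst hv'
  exact (tendsto_nhds_unique hy (hf.tendsto.comp hu)).symm ▸ rfl

/-- Corollary 2 on composite mappings: if the point-to-point mapping `f` is continuous at `x` and
the point-to-set mapping `B` is closed at `f(x)`, then the composite `C = B ∘ f` is closed at `x`.
[cite: LuenbergerYe2008, §6.6 Corollary 2 (composition of a continuous point-to-point mapping
with a closed mapping)] -/
theorem SeqClosedAt.comp_continuousAt {f : X → Y} {B : Y → Set W} {x : X} (hB : SeqClosedAt B (f x))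
    (hf : ContinuousAt f x) : SeqClosedAt (fun x' => B (f x')) x :=
  fun u v y hu hv hy => hB (f ∘ u) v y (hf.tendsto.comp hu) hv hy

/-- `Z` is a *descent function* for the solution set `Γ` and the algorithm `A`: outside `Γ` every
step strictly decreases `Z`, inside `Γ` no step increases it (continuity is kept as a separate
hypothesis). [cite: LuenbergerYe2008, §6.6 Definition (descent function)] -/
def IsDescentFunction (Z : X → ℝ) (Γ : Set X) (A : X → Set X) : Prop :=
  (∀ x, x ∉ Γ → ∀ y ∈ A x, Z y < Z x) ∧ (∀ x, x ∈ Γ → ∀ y ∈ A x, Z y ≤ Z x)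

omit [TopologicalSpace X] in
/-- Along a sequence generated by the algorithm, a descent function is nonincreasing ("by the
monotonicity of Z on the sequence {x_k}"). [cite: LuenbergerYe2008, §6.6 Global Convergence
Theorem, proof] -/
theorem antitone_descent {Z : X → ℝ} {Γ : Set X} {A : X → Set X} (hZ : IsDescentFunction Z Γ A)
    {x : ℕ → X} (hstep : ∀ k, x (k + 1) ∈ A (x k)) : Antitone (Z ∘ x) := by
  refine antitone_nat_of_succ_le fun k => ?_
  by_cases hk : x k ∈ Γ
  · exact hZ.2 _ hk _ (hstep k)
  · exact (hZ.1 _ hk _ (hstep k)).le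

/-- First half of the proof: if `Z(x_k)` is nonincreasing and the subsequence `x_{φ k}` converges
to `x`, then `Z(x_k) → Z(x)` along the entire sequence (monotone and convergent along a
subsequence). [cite: LuenbergerYe2008, §6.6 Global Convergence Theorem, proof ("which shows that
Z(x_k) → Z(x)")] -/
theorem tendsto_value_of_subseq {Z : X → ℝ} (hZc : Continuous Z) {x : ℕ → X}
    (hanti : Antitone (Z ∘ x)) {φ : ℕ → ℕ} (hφ : StrictMono φ) {xs : X}
    (hlim : Tendsto (x ∘ φ) atTop (𝓝 xs)) : Tendsto (Z ∘ x) atTop (𝓝 (Z xs)) := by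
  -- the subsequence of values converges to `Z xs` by continuity
  have hsub : Tendsto (Z ∘ x ∘ φ) atTop (𝓝 (Z xs)) := (hZc.tendsto xs).comp hlim
  -- an antitone sequence lies above the limit of any of its subsequences
  have hlow : ∀ k, Z xs ≤ Z (x k) := by
    intro k
    have h1 : Z xs ≤ (Z ∘ x ∘ φ) k :=
      (hanti.comp_monotone hφ.monotone).le_of_tendsto hsub k
    exact h1.trans (hanti (hφ.id_le k))
  have hbdd : BddBelow (Set.range (Z ∘ x)) := ⟨Z xs, by rintro _ ⟨k, rfl⟩; exact hlow k⟩
  have hconv : Tendsto (Z ∘ x) atTop (𝓝 (⨅ k, (Z ∘ x) k)) := tendsto_atTop_ciInf hanti hbdd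
  have hsub' : Tendsto (Z ∘ x ∘ φ) atTop (𝓝 (⨅ k, (Z ∘ x) k)) := hconv.comp hφ.tendsto_atTop
  rwa [tendsto_nhds_unique hsub' hsub] at hconv

/-- The same for a sequence generated by the algorithm with a descent function.
[cite: LuenbergerYe2008, §6.6 Global Convergence Theorem, proof (first part)] -/
theorem tendsto_descent_of_subseq {Z : X → ℝ} (hZc : Continuous Z) {Γ : Set X} {A : X → Set X}
    (hZ : IsDescentFunction Z Γ A) {x : ℕ → X} (hstep : ∀ k, x (k + 1) ∈ A (x k))
    {φ : ℕ → ℕ} (hφ : StrictMono φ) {xs : X} (hlim : Tendsto (x ∘ φ) atTop (𝓝 xs)) :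
    Tendsto (Z ∘ x) atTop (𝓝 (Z xs)) :=
  tendsto_value_of_subseq hZc (antitone_descent hZ hstep) hφ hlim

/-- The common core of the Global Convergence and Spacer Step Theorems (second half of the proof):
if `Z(x_k)` is nonincreasing, the steps `x_{φk} ↦ x_{φk+1}` are steps of an algorithm `B` that
strictly decreases `Z` and is closed outside `Γ`, the points `x_{φk+1}` lie in a sequentially
compact set, and `x_{φk} → x`, then `x ∈ Γ` — otherwise a further subsequence `x_{φk+1} → x̄`
gives `x̄ ∈ B(x)` with `Z(x̄) = Z(x)`, contradicting descent.
[cite: LuenbergerYe2008, §6.6 Global Convergence Theorem, proof (second part)] -/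
theorem mem_solutionSet_of_spacer (B : X → Set X) (Γ : Set X) (Z : X → ℝ) (hZc : Continuous Z)
    (hdesc : ∀ x, x ∉ Γ → ∀ y ∈ B x, Z y < Z x) (hclosed : ∀ x, x ∉ Γ → SeqClosedAt B x)
    {S : Set X} (hS : IsSeqCompact S) {x : ℕ → X} (hanti : Antitone (Z ∘ x)) {φ : ℕ → ℕ}
    (hφ : StrictMono φ) (hstep : ∀ k, x (φ k + 1) ∈ B (x (φ k))) (hxS : ∀ k, x (φ k + 1) ∈ S)
    {xs : X} (hlim : Tendsto (x ∘ φ) atTop (𝓝 xs)) : xs ∈ Γ := by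
  by_contra hxs
  have hZx : Tendsto (Z ∘ x) atTop (𝓝 (Z xs)) := tendsto_value_of_subseq hZc hanti hφ hlim
  -- the shifted subsequence `x_{φ k + 1}` has a convergent subsequence
  obtain ⟨y, -, ψ, hψ, hy⟩ := hS (x := fun k => x (φ k + 1)) fun k => hxS _
  -- closedness of `B` at `xs`: `x_{φ(ψ i)} → xs`, `x_{φ(ψ i)+1} ∈ B(x_{φ(ψ i)})`, `→ y`
  have hyB : y ∈ B xs :=
    hclosed xs hxs (fun i => x (φ (ψ i))) (fun i => x (φ (ψ i) + 1)) y
      (hlim.comp hψ.tendsto_atTop) (fun i => hstep _) hy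
  -- but `Z y = Z xs`, both being limits of subsequences of `Z(x_k)`
  have hZy : Tendsto (fun i => Z (x (φ (ψ i) + 1))) atTop (𝓝 (Z y)) := (hZc.tendsto y).comp hy
  have hidx : StrictMono fun i => φ (ψ i) + 1 := fun i j hij =>
    Nat.add_lt_add_right (hφ (hψ hij)) 1
  have hZy' : Tendsto (fun i => Z (x (φ (ψ i) + 1))) atTop (𝓝 (Z xs)) :=
    hZx.comp hidx.tendsto_atTop
  exact absurd (tendsto_nhds_unique hZy hZy') (hdesc xs hxs y hyB).ne

/-- **Global Convergence Theorem** (Zangwill). Let `x_{k+1} ∈ A(x_k)` with all `x_k` in a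
sequentially compact set `S`, let `Z` be a continuous descent function for `Γ` and `A`, and let `A`
be closed at every point outside `Γ`. Then the limit of any convergent subsequence of `(x_k)` lies
in the solution set `Γ`. [cite: LuenbergerYe2008, §6.6 Global Convergence Theorem] -/
theorem globalConvergence (A : X → Set X) (Γ : Set X) (Z : X → ℝ) (hZc : Continuous Z)
    (hZ : IsDescentFunction Z Γ A) (hclosed : ∀ x, x ∉ Γ → SeqClosedAt A x) {S : Set X}
    (hS : IsSeqCompact S) {x : ℕ → X} (hxS : ∀ k, x k ∈ S) (hstep : ∀ k, x (k + 1) ∈ A (x k))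
    {φ : ℕ → ℕ} (hφ : StrictMono φ) {xs : X} (hlim : Tendsto (x ∘ φ) atTop (𝓝 xs)) :
    xs ∈ Γ :=
  mem_solutionSet_of_spacer A Γ Z hZc hZ.1 hclosed hS (antitone_descent hZ hstep) hφ
    (fun _ => hstep _) (fun _ => hxS _) hlim

/-- **Spacer Step Theorem** (§7.10 of the held copy; §8.x of the Springer printing). Let `B` be
closed outside `Γ` with descent function `Z`; let `(x_k)` satisfy `Z(x_{k+1}) ≤ Z(x_k)` for all
`k` and `x_{k+1} ∈ B(x_k)` for `k` in an infinite index set `H = {φ(0) < φ(1) < ⋯}`; suppose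
`S = {x : Z(x) ≤ Z(x_0)}` is (sequentially) compact. Then the limit of any convergent subsequence
of `(x_k)_{k ∈ H}` is a solution. [cite: LuenbergerYe2008, §7.10 Spacer Step Theorem] -/
theorem spacerStep (B : X → Set X) (Γ : Set X) (Z : X → ℝ) (hZc : Continuous Z)
    (hZ : IsDescentFunction Z Γ B) (hclosed : ∀ x, x ∉ Γ → SeqClosedAt B x) {x : ℕ → X}
    (hmono : ∀ k, Z (x (k + 1)) ≤ Z (x k)) {φ : ℕ → ℕ} (hφ : StrictMono φ)
    (hH : ∀ k, x (φ k + 1) ∈ B (x (φ k))) (hS : IsSeqCompact {y | Z y ≤ Z (x 0)})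
    {ψ : ℕ → ℕ} (hψ : StrictMono ψ) {xs : X} (hlim : Tendsto (x ∘ φ ∘ ψ) atTop (𝓝 xs)) :
    xs ∈ Γ := by
  have hanti : Antitone (Z ∘ x) := antitone_nat_of_succ_le hmono
  exact mem_solutionSet_of_spacer B Γ Z hZc hZ.1 hclosed hS hanti (hφ.comp hψ)
    (fun k => hH (ψ k)) (fun k => hanti (Nat.zero_le _)) hlim

/-- **Corollary.** If, under the conditions of the Global Convergence Theorem, the solution set
consists of a single point `xbar`, then the whole sequence converges to `xbar`.
[cite: LuenbergerYe2008, §6.6 Corollary to the Global Convergence Theorem] -/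
theorem tendsto_of_solutionSet_singleton (A : X → Set X) (xbar : X) (Z : X → ℝ) (hZc : Continuous Z)
    (hZ : IsDescentFunction Z {xbar} A) (hclosed : ∀ x, x ≠ xbar → SeqClosedAt A x) {S : Set X}
    (hS : IsSeqCompact S) {x : ℕ → X} (hxS : ∀ k, x k ∈ S) (hstep : ∀ k, x (k + 1) ∈ A (x k)) :
    Tendsto x atTop (𝓝 xbar) := by
  -- every subsequence has a further subsequence converging to `xbar`
  refine tendsto_of_subseq_tendsto fun ns hns => ?_
  obtain ⟨φ₁, hφ₁, hmono⟩ := strictMono_subseq_of_tendsto_atTop hns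
  obtain ⟨y, -, ψ, hψ, hy⟩ := hS (x := fun k => x (ns (φ₁ k))) fun k => hxS _
  have hsm : StrictMono (ns ∘ φ₁ ∘ ψ) := hmono.comp hψ
  have hy' : Tendsto (x ∘ (ns ∘ φ₁ ∘ ψ)) atTop (𝓝 y) := hy
  have hyΓ : y ∈ ({xbar} : Set X) :=
    globalConvergence A {xbar} Z hZc hZ (fun x hx => hclosed x hx) hS hxS hstep hsm hy'
  rw [Set.mem_singleton_iff] at hyΓ
  subst hyΓ
  exact ⟨φ₁ ∘ ψ, hy⟩

/-- Example 4: the point-to-point algorithm on the real line `A(x) = ½(x − 1) + 1` for `x > 1`,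
`A(x) = ½x` for `x ≤ 1`. [cite: LuenbergerYe2008, §6.6 Example 4] -/
noncomputable def example4Map (x : ℝ) : ℝ := if 1 < x then (x - 1) / 2 + 1 else x / 2

/-- Example 4: `Z(x) = |x|` is a descent function for the solution set `Γ = {0}` and the algorithm
`x ↦ {A(x)}`. [cite: LuenbergerYe2008, §6.6 Example 4 ("a descent function for this solution set
and this algorithm is Z(x) = |x|")] -/
theorem example4_isDescentFunction :
    IsDescentFunction (fun x : ℝ => |x|) {0} fun x => ({example4Map x} : Set ℝ) := by
  refine ⟨fun x hx y hy => ?_, fun x hx y hy => ?_⟩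
  · rw [Set.mem_singleton_iff] at hy
    subst hy
    have hx0 : x ≠ 0 := hx
    dsimp only
    unfold example4Map
    split_ifs with h1
    · rw [abs_of_pos (by linarith), abs_of_pos (by linarith)]
      linarith
    · rcases lt_or_gt_of_ne hx0 with hneg | hpos
      · rw [abs_of_neg (by linarith), abs_of_neg hneg]; linarith
      · rw [abs_of_pos (by linarith), abs_of_pos hpos]; linarith
  · rw [Set.mem_singleton_iff] at hy
    have hx0 : x = 0 := hx
    subst hy; subst hx0
    simp [example4Map]

/-- Example 4: the algorithm is NOT closed at `x = 1` — `x_k = 1 + 1/(k+1) → 1`,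
`A(x_k) = 1 + 1/(2(k+1)) → 1`, but `A(1) = ½ ≠ 1`. [cite: LuenbergerYe2008, §6.6 Example 4 ("The
difficulty is that A is not closed at x = 1")] -/
theorem example4_not_seqClosedAt_one : ¬ SeqClosedAt (fun x => ({example4Map x} : Set ℝ)) 1 := by
  intro h
  have h0 : Tendsto (fun k : ℕ => 1 / ((k : ℝ) + 1)) atTop (𝓝 0) :=
    tendsto_one_div_add_atTop_nhds_zero_nat
  have hu : Tendsto (fun k : ℕ => 1 + 1 / ((k : ℝ) + 1)) atTop (𝓝 1) := by
    simpa using h0.const_add 1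
  have hv : Tendsto (fun k : ℕ => 1 / ((k : ℝ) + 1) / 2 + 1) atTop (𝓝 1) := by
    simpa using (h0.div_const 2).add_const 1
  have hmem : ∀ k : ℕ, 1 / ((k : ℝ) + 1) / 2 + 1 ∈ ({example4Map (1 + 1 / ((k : ℝ) + 1))} : Set ℝ) := by
    intro k
    have hk : (0 : ℝ) < 1 / ((k : ℝ) + 1) := by positivity
    rw [Set.mem_singleton_iff, example4Map, if_pos (by linarith)]
    ring
  have h1 := h _ _ 1 hu hmem hv
  rw [Set.mem_singleton_iff, example4Map, if_neg (lt_irrefl _)] at h1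
  norm_num at h1

/-- Example 4: started at `x₀ > 1` the algorithm generates `x_k = 1 + (x₀ − 1)/2^k`.
[cite: LuenbergerYe2008, §6.6 Example 4 ("starting from x > 1, the algorithm generates a sequence
converging to x = 1")] -/
theorem example4_iterate {x₀ : ℝ} (hx₀ : 1 < x₀) (k : ℕ) :
    example4Map^[k] x₀ = 1 + (x₀ - 1) * (1 / 2) ^ k := by
  induction k with
  | zero => simp
  | succ k ih =>
    rw [Function.iterate_succ_apply', ih, example4Map, if_pos]
    · ring
    · have : 0 < (x₀ - 1) * (1 / 2) ^ k := by positivity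
      linarith

/-- Example 4, conclusion: from `x₀ > 1` the generated sequence converges to `x = 1`, which is not in
the solution set `{0}` — condition (iii) (closedness outside `Γ`) cannot be dropped from the Global
Convergence Theorem. [cite: LuenbergerYe2008, §6.6 Example 4] -/
theorem example4_tendsto_one_notMem {x₀ : ℝ} (hx₀ : 1 < x₀) :
    Tendsto (fun k => example4Map^[k] x₀) atTop (𝓝 1) ∧ (1 : ℝ) ∉ ({0} : Set ℝ) := by
  refine ⟨?_, by simp⟩
  have h : Tendsto (fun k : ℕ => 1 + (x₀ - 1) * (1 / 2 : ℝ) ^ k) atTop (𝓝 1) := by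
    have hp : Tendsto (fun k : ℕ => (1 / 2 : ℝ) ^ k) atTop (𝓝 0) :=
      tendsto_pow_atTop_nhds_zero_of_lt_one (by norm_num) (by norm_num)
    simpa using (hp.const_mul (x₀ - 1)).const_add 1
  exact h.congr fun k => (example4_iterate hx₀ k).symm

/-- Remark on hypothesis (i): in a (pseudo)metric space a compact set is sequentially compact, so
the book's hypothesis "all x_k are contained in a compact set S" yields the convergent subsequences
used above. [cite: LuenbergerYe2008, §6.6 Global Convergence Theorem, hypothesis (i)] -/
theorem tendsto_subseq_of_compact {Y : Type*} [PseudoMetricSpace Y] {S : Set Y} (hS : IsCompact S)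
    {x : ℕ → Y} (hxS : ∀ k, x k ∈ S) :
    ∃ xs ∈ S, ∃ φ : ℕ → ℕ, StrictMono φ ∧ Tendsto (x ∘ φ) atTop (𝓝 xs) :=
  hS.isSeqCompact hxS

end Literature.Analysis.Convex.ZangwillGlobalConvergence
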